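import Literature.AlgebraicGeometry.Deligne1982.RosatiClassRealTwist
import HarnessLib

/-!
# Deligne 1982 §5 (c), p. 39, one factor: the hermitian coefficient of the REAL TWIST — «the discriminant of
# `φ` is `∏ᵢ fᵢ(ζ₁⁻¹ζᵢ)`», i.e. `ζ_{D_f h} = ζ_h / (2f)` on the eigen-components, and its Riemann positivity for
# totally positive `f`

Stage-2 Hodge-CM cell `pub-hodgecm2` (COR-CM), literature seat Milne (`lit-milne`, gen 55, layer L-B.2a of the programme
`M55-SPLIT-TWIST` toward `HodgeTheory.Andre1992_hodgeClasses_cmType_mem_span_pullback_splitWeilClassesCM`). THEOREMS ONLY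
(D-0026, net debt 0); `HC_CM` does not occur here.

## Source, verbatim

P. Deligne (notes by J. S. Milne), *Hodge cycles on abelian varieties*, LNM 900 (1982) [Deligne1982HodgeCycles], §5 (c)
p. 39: «For any totally positive elements `fᵢ` in `F` […] `θ = Σᵢ fᵢθᵢ` is a polarization for `A`. […] `ψᵢ(x, y) =
Tr_{E/ℚ}(ζᵢ x ȳ)` […] `Im σ(ζᵢ) > 0 ⟺ σ ∈ Φᵢ` […] The discriminant of `φ` is `∏ᵢ fᵢ (ζ₁⁻¹ζᵢ)`»; F. Charles, C. Schnell,
*Notes on absolute Hodge classes*, proof of Prop. 11.5.22 («the Riemann form … `Σ fᵢψᵢ` … corresponds to the hermitian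
form `φ(v, w) = Σ fᵢζᵢ vᵢw̄ᵢ`»); J. S. Milne, arXiv:2010.08857, 2.2.

## What is proved (on the carriers, `Q_h = h^{g-1} ⌣ (· ⌣ ·)`, setting of `RosatiClassRealTwist` with the eigenbasis
indexed by the embeddings `σ : K → ℂ`)

For `h ∈ H²(A(ℂ); ℂ)` killed by the imaginary derivations, `f ∈ 𝓞_K` real and non-zero, and the real twist
`T = D_f h = (𝟙 + u f)^* h - h - u(f)^* h` of `Deligne1982/RosatiClassRealTwist`:

* `exists_scalar_realTwist_self` — ONE non-zero scalar `d` (`= det u_f = 2^g N_{F/ℚ}(f)`) with `T^g = d · h^g`,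
  `T^{g-1} ⌣ T = d · h^{g-1} ⌣ h` (the self-normalising top classes in the pairing degree) and
  `Q_T(u(2f)^* y, z) = d · Q_h(y, z)` (needs Rosati-compatibility of `h` for the block structure);
* `realTwist_eigenCoeff` — **`ζ_T = ζ_h / (2f)`**: if `Q_h(x_σ, x_σ̄) = σ(ζ) · h^{g-1} ⌣ h` on the eigen-components
  `x_σ = coord_σ(x) b_σ` of a class `x` (the output of `Deligne1982.exists_hermitianCoeff_of_rosatiClass`), then
  `Q_T(x_σ, x_σ̄) = σ(ζ/(2f)) · T^{g-1} ⌣ T` — the scalar `d` CANCELS against the self-normalisation, so no arithmetic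
  of `det u_f` is needed (Deligne: `θᵢ ↦ fᵢθᵢ` multiplies `ζᵢ` by `fᵢ`; here `ψ ↦ 2ψ(f·,·)` divides the
  SELF-NORMALISED coefficient by `2f`, the normalising top class absorbing `(2f)^g`-type factors);
* `imaginary_div_real`, `adapted_div_of_totallyPositive`, `antiAdapted_div_of_totallyPositive` — `ζ/(2f)` is again
  totally imaginary, and for TOTALLY POSITIVE `f` it is adapted to the same CM type as `ζ` («for any totally positive
  elements `fᵢ` … is a polarization»: positivity is what keeps `Im σ(ζᵢ) > 0 ⟺ σ ∈ Φᵢ`).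

## References

* [Deligne1982HodgeCycles] P. Deligne, *Hodge cycles on abelian varieties*, LNM 900 (1982), §5 (c) pp. 38–39; §4 Lemma 4.6.
* [CharlesSchnell2014Notes] F. Charles, C. Schnell, *Notes on absolute Hodge classes*, Prop. 11.5.22 and its proof.
* [Milne2020HodgeClassesAV] J. S. Milne, arXiv:2010.08857, 2.2.
* [LangeBirkenhake1992] H. Lange, Ch. Birkenhake, *Complex Abelian Varieties* (1992), Lemma 1.1.17, §5.2.
-/

noncomputable section

open CategoryTheory NumberField
open Literature.AlgebraicTopology.SingularHomology
open Literature.AlgebraicGeometry.HodgeTheory Literature.AlgebraicGeometry.Motives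
open Literature.AlgebraicGeometry.ComplexMultiplication
open Literature.AlgebraicGeometry.Milne1999 (exteriorPullback_top)
open Literature.Geometry.Kaehler (lefschetzPow)

namespace Literature.AlgebraicGeometry.Deligne1982

/-! ### §1 Arithmetic of `ζ / (2f)` in the CM field -/

section Field

variable {K : Type*} [Field K] [NumberField K] [IsCMField K]

/-- `ζ/(2f)` is totally imaginary for `ζ` totally imaginary and `f` real. [cite: Deligne1982HodgeCycles, §5 (c) p. 39] -/
theorem imaginary_div_real {ζ f : K} (hζ : IsCMField.complexConj K ζ = -ζ) (hf : IsCMField.complexConj K f = f) :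
    IsCMField.complexConj K (ζ / (2 * f)) = -(ζ / (2 * f)) := by
  rw [map_div₀, map_mul, hζ, hf, map_ofNat, neg_div]

/-- `Im σ(ζ/(2f)) = Im σ(ζ) / (2 Re σ(f))` for `f` real. [cite: Deligne1982HodgeCycles, §5 (c) p. 39] -/
theorem im_apply_div_real (σ : K →+* ℂ) (ζ : K) {f : K} (hf : IsCMField.complexConj K f = f) :
    (σ (ζ / (2 * f))).im = (σ ζ).im / (2 * (σ f).re) := by
  have hreal : σ f = ((σ f).re : ℂ) :=
    (Complex.conj_eq_iff_re.1 (by rw [← IsCMField.complexEmbedding_complexConj K σ f, hf])).symm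
  have h2 : (2 : ℂ) * σ f = ((2 * (σ f).re : ℝ) : ℂ) := by
    conv_lhs => rw [hreal]
    push_cast
    ring
  rw [map_div₀, map_mul, map_ofNat, h2, Complex.div_ofReal_im]

/-- **Totally positive rescaling keeps Riemann positivity**: if `σ ∈ Φ ⟺ Im σ(ζ) > 0` for all `σ` and `f` is real and
totally positive (`Re σ(f) > 0` for all `σ`), then `σ ∈ Φ ⟺ Im σ(ζ/(2f)) > 0` for all `σ`.
[cite: Deligne1982HodgeCycles, §5 (c) p. 39 («for any totally positive elements fᵢ»)] -/
theorem adapted_div_of_totallyPositive (Φ : CMType K) {ζ f : K} (hf : IsCMField.complexConj K f = f)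
    (hpos : ∀ σ : K →+* ℂ, 0 < (σ f).re) (had : ∀ σ : K →+* ℂ, σ ∈ Φ.1 ↔ 0 < (σ ζ).im) :
    ∀ σ : K →+* ℂ, σ ∈ Φ.1 ↔ 0 < (σ (ζ / (2 * f))).im := by
  intro σ
  rw [had σ, im_apply_div_real σ ζ hf]
  have h2 : 0 < 2 * (σ f).re := by have := hpos σ; positivity
  rw [div_pos_iff_of_pos_right h2]

/-- The same for the opposite sign: `σ ∈ Φ ⟺ Im σ(ζ) < 0` is kept by a totally positive rescaling.
[cite: Deligne1982HodgeCycles, §5 (c) p. 39] -/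
theorem antiAdapted_div_of_totallyPositive (Φ : CMType K) {ζ f : K} (hf : IsCMField.complexConj K f = f)
    (hpos : ∀ σ : K →+* ℂ, 0 < (σ f).re) (had : ∀ σ : K →+* ℂ, σ ∈ Φ.1 ↔ (σ ζ).im < 0) :
    ∀ σ : K →+* ℂ, σ ∈ Φ.1 ↔ (σ (ζ / (2 * f))).im < 0 := by
  intro σ
  rw [had σ, im_apply_div_real σ ζ hf]
  have h2 : 0 < 2 * (σ f).re := by have := hpos σ; positivity
  refine ⟨fun h ↦ div_neg_of_neg_of_pos h h2, fun h ↦ ?_⟩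
  by_contra hc
  push Not at hc
  exact absurd h (not_lt.2 (div_nonneg hc h2.le))

end Field

/-! ### §2 The scalar of the twist on the self-normalising top classes -/

section Twist

variable {K : Type*} [Field K] [NumberField K] [IsCMField K]
variable {A : AbelianVariety ℂ} {u : 𝓞 K → (A ⟶ A)} {b : Module.Basis (K →+* ℂ) ℂ (complexBetti A.X 1)}

/-- A diagonal automorphism of `H¹` with prescribed non-zero eigenvalues on a basis. [folklore] -/
private theorem exists_linearEquiv_diagonal' {ι : Type*} (b : Module.Basis ι ℂ (complexBetti A.X 1)) (γ : ι → ℂ)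
    (hγ : ∀ i, γ i ≠ 0) :
    ∃ uH : complexBetti A.X 1 ≃ₗ[ℂ] complexBetti A.X 1, ∀ i, uH (b i) = γ i • b i := by
  refine ⟨b.equiv (b.unitsSMul fun i ↦ Units.mk0 (γ i) (hγ i)) (Equiv.refl ι), fun i ↦ ?_⟩
  rw [Module.Basis.equiv_apply, Equiv.refl_apply, Module.Basis.unitsSMul_apply, Units.smul_mk0]

omit [NumberField K] [IsCMField K] in
open scoped Classical in
/-- The twist weights are non-zero for `f ≠ 0`. [folklore] -/
private theorem twistWeight_ne_zero' (Φ : CMType K) {f : 𝓞 K} (hf0 : (f : K) ≠ 0) (σ : K →+* ℂ) :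
    (if σ ∈ Φ.1 then 2 * σ (f : K) else 1) ≠ 0 := by
  split_ifs
  · exact mul_ne_zero two_ne_zero ((map_ne_zero σ).2 hf0)
  · exact one_ne_zero

/-- **The scalar of the real twist on the self-normalising top classes.** For `dim A = m + 1`, `h` killed by the
imaginary derivations and Rosati-compatible, `f ∈ 𝓞_K` real and non-zero (and any CM type `Φ`, used only to build
the diagonal automorphism): ONE non-zero scalar `d` with `T^{dim A} = d · h^{dim A}`, `T^m ⌣ T = d · h^m ⌣ h` (the top
class of the pairing degree, `Lᵐ_T T`) and `Q_T(u(2f)^* y, z) = d · Q_h(y, z)` for `T = D_f h`.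
[cite: Deligne1982HodgeCycles, §5 (c) p. 39] [cite: LangeBirkenhake1992, Lemma 1.1.17 and §5.2] -/
theorem exists_scalar_realTwist_self {m : ℕ} (hA : A.dim = m + 1)
    (hb : ∀ (a : 𝓞 K) (σ : K →+* ℂ), complexBetti.map (u a).hom.hom.hom 1 (b σ) = σ (a : K) • b σ)
    (Φ : CMType K) {f : 𝓞 K} (hf : IsCMField.complexConj K (f : K) = (f : K)) (hf0 : (f : K) ≠ 0)
    {h : complexBetti A.X 2}
    (hkill : ∀ c : 𝓞 K, IsCMField.complexConj K (c : K) = -(c : K) →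
      complexBetti.map (𝟙 A + u c).hom.hom.hom 2 h = h + complexBetti.map (u c).hom.hom.hom 2 h)
    (hros : ∀ (a ac : 𝓞 K), (ac : K) = IsCMField.complexConj K (a : K) → ∀ x y : complexBetti A.X 1,
      polarizationPairingOne A.X h m (complexBetti.map (u a).hom.hom.hom 1 x) y =
        polarizationPairingOne A.X h m x (complexBetti.map (u ac).hom.hom.hom 1 y)) :
    ∃ d : ℂ, d ≠ 0 ∧
      cupPowTwo (complexBetti.map (𝟙 A + u f).hom.hom.hom 2 h - h - complexBetti.map (u f).hom.hom.hom 2 h) A.dim =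
        d • cupPowTwo h A.dim ∧
      lefschetzPow (complexBetti.map (𝟙 A + u f).hom.hom.hom 2 h - h - complexBetti.map (u f).hom.hom.hom 2 h) m 2
          (complexBetti.map (𝟙 A + u f).hom.hom.hom 2 h - h - complexBetti.map (u f).hom.hom.hom 2 h) =
        d • lefschetzPow h m 2 h ∧
      ∀ y z : complexBetti A.X 1,
        polarizationPairingOne A.X
            (complexBetti.map (𝟙 A + u f).hom.hom.hom 2 h - h - complexBetti.map (u f).hom.hom.hom 2 h) m
            (complexBetti.map (u (2 * f)).hom.hom.hom 1 y) z =
          d • polarizationPairingOne A.X h m y z := by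
  classical
  have hΛ := AbelianVariety.hasExteriorCohomologyH1_complexPoints A
  obtain ⟨uH, huH⟩ := exists_linearEquiv_diagonal' b _ fun σ ↦ twistWeight_ne_zero' Φ hf0 σ
  have hT := realTwist_eq_exteriorPullback (τ := fun σ : K →+* ℂ ↦ σ) hb Φ hf huH hkill hΛ
  have hd : Module.finrank ℂ (complexBetti A.X 1) = 2 + 2 * m := by
    rw [AbelianVariety.finrank_complexBetti_one, hA]; ring
  refine ⟨LinearMap.det (uH : complexBetti A.X 1 →ₗ[ℂ] complexBetti A.X 1),
    left_ne_zero_of_mul_eq_one (LinearEquiv.det_mul_det_symm uH),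
    cupPowTwo_realTwist (τ := fun σ : K →+* ℂ ↦ σ) hb Φ hf huH hkill, ?_,
    fun y z ↦ polarizationPairingOne_realTwist (τ := fun σ : K →+* ℂ ↦ σ) hA hb Φ hf hf0 huH hkill hros y z⟩
  rw [hT, ← exteriorPullback_lefschetzPow_eq hΛ uH.toLinearMap h 2 h m, exteriorPullback_top hΛ uH.toLinearMap hd]

/-- **`ζ_T = ζ_h / (2f)` on the eigen-components** (Deligne's «the discriminant of `φ` is `∏ᵢ fᵢ(ζ₁⁻¹ζᵢ)`», one factor):
if `Q_h(x_σ, x_σ̄) = σ(ζ) · h^m ⌣ h` for the eigen-components `x_σ = coord_σ(x) b_σ` of a class `x ∈ H¹`, then for the real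
twist `T = D_f h` (`f ∈ 𝓞_K` real, non-zero) `Q_T(x_σ, x_σ̄) = σ(ζ/(2f)) · T^m ⌣ T`: `x_σ` is an eigenvector of `u(2f)^*`
with eigenvalue `2σ(f)`, and the scalar `d` of `exists_scalar_realTwist_self` appears on both sides.
[cite: Deligne1982HodgeCycles, §5 (c) p. 39] [cite: CharlesSchnell2014Notes, Prop. 11.5.22 (proof)] -/
theorem realTwist_eigenCoeff {m : ℕ} (hA : A.dim = m + 1)
    (hb : ∀ (a : 𝓞 K) (σ : K →+* ℂ), complexBetti.map (u a).hom.hom.hom 1 (b σ) = σ (a : K) • b σ)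
    (Φ : CMType K) {f : 𝓞 K} (hf : IsCMField.complexConj K (f : K) = (f : K)) (hf0 : (f : K) ≠ 0)
    {h : complexBetti A.X 2}
    (hkill : ∀ c : 𝓞 K, IsCMField.complexConj K (c : K) = -(c : K) →
      complexBetti.map (𝟙 A + u c).hom.hom.hom 2 h = h + complexBetti.map (u c).hom.hom.hom 2 h)
    (hros : ∀ (a ac : 𝓞 K), (ac : K) = IsCMField.complexConj K (a : K) → ∀ x y : complexBetti A.X 1,
      polarizationPairingOne A.X h m (complexBetti.map (u a).hom.hom.hom 1 x) y =
        polarizationPairingOne A.X h m x (complexBetti.map (u ac).hom.hom.hom 1 y))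
    {x : complexBetti A.X 1} {ζ : K}
    (hcoef : ∀ σ : K →+* ℂ, polarizationPairingOne A.X h m (b.coord σ x • b σ)
        (b.coord (ComplexEmbedding.conjugate σ) x • b (ComplexEmbedding.conjugate σ)) = σ ζ • lefschetzPow h m 2 h)
    (σ : K →+* ℂ) :
    polarizationPairingOne A.X
        (complexBetti.map (𝟙 A + u f).hom.hom.hom 2 h - h - complexBetti.map (u f).hom.hom.hom 2 h) m
        (b.coord σ x • b σ) (b.coord (ComplexEmbedding.conjugate σ) x • b (ComplexEmbedding.conjugate σ)) =
      σ (ζ / (2 * (f : K))) •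
        lefschetzPow (complexBetti.map (𝟙 A + u f).hom.hom.hom 2 h - h - complexBetti.map (u f).hom.hom.hom 2 h) m 2
          (complexBetti.map (𝟙 A + u f).hom.hom.hom 2 h - h - complexBetti.map (u f).hom.hom.hom 2 h) := by
  obtain ⟨d, hd0, -, htop, hshift⟩ := exists_scalar_realTwist_self hA hb Φ hf hf0 hkill hros
  set T := complexBetti.map (𝟙 A + u f).hom.hom.hom 2 h - h - complexBetti.map (u f).hom.hom.hom 2 h with hTdef
  -- `x_σ` is an eigenvector of `u(2f)^*` with the non-zero eigenvalue `σ(2f)`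
  have h2f : σ ((2 * f : 𝓞 K) : K) = 2 * σ (f : K) := by
    rw [show ((2 * f : 𝓞 K) : K) = 2 * (f : K) by norm_cast, map_mul, map_ofNat]
  have h2f0 : σ ((2 * f : 𝓞 K) : K) ≠ 0 := by
    rw [h2f]; exact mul_ne_zero two_ne_zero ((map_ne_zero σ).2 hf0)
  have heig : complexBetti.map (u (2 * f)).hom.hom.hom 1 (b.coord σ x • b σ) =
      σ ((2 * f : 𝓞 K) : K) • (b.coord σ x • b σ) := by
    rw [map_smul, hb, smul_comm]
  -- `σ(2f) Q_T(x_σ, x_σ̄) = Q_T(u(2f)^* x_σ, x_σ̄) = d Q_h(x_σ, x_σ̄) = d σ(ζ) h^m ⌣ h = σ(ζ) T^m ⌣ T`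
  have key : σ ((2 * f : 𝓞 K) : K) • polarizationPairingOne A.X T m (b.coord σ x • b σ)
      (b.coord (ComplexEmbedding.conjugate σ) x • b (ComplexEmbedding.conjugate σ)) = σ ζ • lefschetzPow T m 2 T := by
    rw [← LinearMap.map_smul₂, ← heig, hshift, hcoef, htop, smul_smul, smul_smul, mul_comm d (σ ζ)]
  have hval : σ (ζ / (2 * (f : K))) = (σ ((2 * f : 𝓞 K) : K))⁻¹ * σ ζ := by
    rw [map_div₀, map_mul, map_ofNat, h2f, div_eq_inv_mul]
  rw [hval, ← smul_smul, ← key, smul_smul, inv_mul_cancel₀ h2f0, one_smul]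

end Twist

end Literature.AlgebraicGeometry.Deligne1982

end
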